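import Summits.ABC.ABC.Theorems.SomeWindowSaving.Negative.LowerLaw

/-!
# Twisted Frey family: window membership and pair counting with both edge inequalities

Negative-side support for the crux `TwistAmplification.SomeWindowSaving` (stmt-ABC-1976), cdisprove
gen 3.  The landed `twistFamily_mem_windowSet'` / `card_pairs_le_windowCount'`
(`Negative/TwistFamilyWindow.lean`, `Negative/TwistCounting.lean`) assume `σ > 12`, used only to
discharge the upper edge `M⁺ ≤ N^σ` through `2²⁴ p¹² ≤ p^σ`.  Here both edges are hypotheses:
the lower-edge inequality `(2¹³ p³ d²)^κ ≤ 13824000 p¹² d⁶` and the upper-edge inequality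
`2²⁴ p¹² d⁶ ≤ (p d²)^σ` (`⟸ 2²⁴ p^{12−σ} ≤ d^{2σ−6}`, `upper_edge_of_rpow_le`), for any `σ ≥ 0`:
`twistFamily_mem_windowSet_of_edges`, `card_pairs_le_windowCount_of_edges`.  Used by
`Negative/LowerLawSmallSigma.lean`.
-/

noncomputable section

open UniqueFactorizationMonoid IsDedekindDomain Real WeierstrassCurve Rat.HeightOneSpectrum
open Literature.NumberTheory.EllipticCurves

namespace Summit.ABC.ABC.Theorems.SomeWindowSaving.Negative

section TwistEdges

open Filter

variable {p d : ℕ}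

/-- From `2²⁴ p^{12−σ} ≤ d^{2σ−6}` (`p, d > 0` real) to the upper-edge inequality
`2²⁴ p¹² d⁶ ≤ (p d²)^σ`. -/
theorem upper_edge_of_rpow_le {σ : ℝ} {x z : ℝ} (hx : 0 < x) (hz : 0 < z)
    (h : (2 : ℝ) ^ 24 * x ^ (12 - σ) ≤ z ^ (2 * σ - 6)) :
    (2 : ℝ) ^ 24 * x ^ (12 : ℕ) * z ^ (6 : ℕ) ≤ (x * z ^ (2 : ℕ)) ^ σ := by
  have e1 : (x * z ^ (2 : ℕ)) ^ σ = x ^ σ * z ^ (2 * σ) := by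
    rw [Real.mul_rpow hx.le (by positivity),
      show (z ^ (2 : ℕ) : ℝ) = z ^ (2 : ℝ) by rw [← Real.rpow_natCast]; norm_num,
      ← Real.rpow_mul hz.le]
  have e2 : x ^ (12 : ℕ) = x ^ (12 - σ) * x ^ σ := by
    rw [← Real.rpow_add hx, ← Real.rpow_natCast]
    congr 1; push_cast; ring
  have e3 : z ^ (2 * σ) = z ^ (2 * σ - 6) * z ^ (6 : ℕ) := by
    rw [← Real.rpow_natCast z 6, ← Real.rpow_add hz]
    congr 1; push_cast; ring
  rw [e1, e2, e3]
  have hnn : (0 : ℝ) ≤ x ^ σ * z ^ (6 : ℕ) := by positivity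
  calc (2 : ℝ) ^ 24 * (x ^ (12 - σ) * x ^ σ) * z ^ (6 : ℕ)
      = ((2 : ℝ) ^ 24 * x ^ (12 - σ)) * (x ^ σ * z ^ (6 : ℕ)) := by ring
    _ ≤ z ^ (2 * σ - 6) * (x ^ σ * z ^ (6 : ℕ)) := mul_le_mul_of_nonneg_right h hnn
    _ = x ^ σ * (z ^ (2 * σ - 6) * z ^ (6 : ℕ)) := by ring

/-- **The twisted family sits in the windows, any `σ ≥ 0`** — membership with BOTH edge
inequalities as hypotheses: primes `p ≥ 5`, `d ≥ 5`, `d ∤ 4p²(4p²−1)`, the lower-edge inequality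
`(2¹³ p³ d²)^κ ≤ 13824000 p¹² d⁶` and the upper-edge inequality `2²⁴ p¹² d⁶ ≤ (p d²)^σ` give
`twistFamily p d ∈ windowSet κ σ X` for `X ≥ 2¹³ p³ d²` (same proof as
`twistFamily_mem_windowSet'`, whose `σ > 12` served only to discharge the upper edge). -/
theorem twistFamily_mem_windowSet_of_edges {κ σ : ℝ} (hκ0 : 0 < κ) (hσ0 : 0 ≤ σ)
    (hp : p.Prime) (hd : d.Prime) (h5 : 5 ≤ p) (hd5 : 5 ≤ d)
    (hdM : ¬ (d : ℤ) ∣ 1 * (3 * kOf p) * (1 + 3 * kOf p))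
    (hlow : ((2 : ℝ) ^ 13 * (p : ℝ) ^ 3 * (d : ℝ) ^ 2) ^ κ ≤ 13824000 * (p : ℝ) ^ 12 * (d : ℝ) ^ 6)
    (hup : (2 : ℝ) ^ 24 * (p : ℝ) ^ 12 * (d : ℝ) ^ 6 ≤ ((p : ℝ) * (d : ℝ) ^ 2) ^ σ)
    {X : ℝ} (hX : (2 : ℝ) ^ 13 * (p : ℝ) ^ 3 * (d : ℝ) ^ 2 ≤ X) :
    twistFamily p d ∈ windowSet κ σ X := by
  have hp3 := not_three_dvd_of_prime hp h5
  have hp1 : 1 ≤ p := hp.one_le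
  haveI hE : ((twistFamily p d).baseChange ℚ).IsElliptic :=
    isElliptic_of_twistCovariants (freyFamily_prod_ne_zero hp3 hp1) hd (twistFamily_Δ p d)
  obtain ⟨hNdvd, hNle⟩ := conductorNorm_twistFamily_bounds' hp h5 hd hd5 hdM
  have hNle' : ((((twistFamily p d).baseChange ℚ).conductorNorm ℤ : ℕ) : ℝ) ≤
      (2 : ℝ) ^ 13 * (p : ℝ) ^ 3 * (d : ℝ) ^ 2 := by exact_mod_cast hNle
  have hNge : (p : ℝ) * (d : ℝ) ^ 2 ≤ ((((twistFamily p d).baseChange ℚ).conductorNorm ℤ : ℕ) : ℝ) := by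
    exact_mod_cast Nat.le_of_dvd (conductorNorm_pos_holds _) hNdvd
  obtain ⟨hMlo, hMhi⟩ := maxInv_twistFamily_bounds hp3 (by omega) d
  have hMlo' : (13824000 : ℝ) * (p : ℝ) ^ 12 * (d : ℝ) ^ 6 ≤
      ((max |(twistFamily p d).Δ| (|(twistFamily p d).c₄| ^ 3) : ℤ) : ℝ) := by exact_mod_cast hMlo
  have hMhi' : ((max |(twistFamily p d).Δ| (|(twistFamily p d).c₄| ^ 3) : ℤ) : ℝ) ≤
      (2 : ℝ) ^ 24 * (p : ℝ) ^ 12 * (d : ℝ) ^ 6 := by exact_mod_cast hMhi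
  have hk := one_le_kOf hp3 hp1
  have hc₄0 : (twistFamily p d).c₄ ≠ 0 := by
    rw [(twistFamily_c₄_Δ_eq p d).1]
    exact mul_ne_zero (pow_ne_zero _ (by exact_mod_cast hd.ne_zero)) (freyFamily_c₄_pos hp3 hp1).ne'
  have hc₆0 : (twistFamily p d).c₆ ≠ 0 := by
    rw [twistFamily_c₆]
    have h1 : (0 : ℤ) < 3 * kOf p - 1 := by omega
    have h2 : (0 : ℤ) < 3 * kOf p + 2 := by omega
    have h3 : (0 : ℤ) < 6 * kOf p + 1 := by omega
    exact mul_ne_zero (mul_ne_zero (by norm_num) (pow_ne_zero _ (by exact_mod_cast hd.ne_zero)))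
      (mul_pos (mul_pos h1 h2) h3).ne'
  have ha₂ := redShift_spec ((d : ℤ) * (3 * kOf p - 1))
  refine ⟨hE, isMinimalAt_of_twistCovariants isCoprime_one_left (freyFamily_prod_ne_zero hp3 hp1)
      (not_sixteen_dvd_freyFamily_prod hp3 (odd_of_prime_of_five_le hp h5)) hd hd5
      hdM (twistFamily_c₄ p d) (twistFamily_Δ p d),
    Or.inl rfl, Or.inl rfl, ha₂, hc₄0, hc₆0, hNle'.trans hX, ?_, ?_⟩
  · calc ((((twistFamily p d).baseChange ℚ).conductorNorm ℤ : ℕ) : ℝ) ^ κ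
        ≤ ((2 : ℝ) ^ 13 * (p : ℝ) ^ 3 * (d : ℝ) ^ 2) ^ κ := Real.rpow_le_rpow (by positivity) hNle' hκ0.le
      _ ≤ 13824000 * (p : ℝ) ^ 12 * (d : ℝ) ^ 6 := hlow
      _ ≤ _ := hMlo'
  · calc ((max |(twistFamily p d).Δ| (|(twistFamily p d).c₄| ^ 3) : ℤ) : ℝ)
        ≤ (2 : ℝ) ^ 24 * (p : ℝ) ^ 12 * (d : ℝ) ^ 6 := hMhi'
      _ ≤ ((p : ℝ) * (d : ℝ) ^ 2) ^ σ := hup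
      _ ≤ ((((twistFamily p d).baseChange ℚ).conductorNorm ℤ : ℕ) : ℝ) ^ σ :=
          Real.rpow_le_rpow (by positivity) hNge hσ0

/-- **Pair counting with exclusions, any `σ ≥ 0`**: as `card_pairs_le_windowCount'`, with the
upper-edge inequality supplied on the ranges `p ∈ (m₁, n₁]`, `d ∈ (m₂, n₂]` (`4 ≤ m₁`, `4 ≤ m₂`). -/
theorem card_pairs_le_windowCount_of_edges {κ σ : ℝ} (hκ3 : 3 < κ) (hκ4 : κ < 4) (hσ0 : 0 ≤ σ)
    {m₁ n₁ m₂ n₂ E : ℕ} {X : ℝ} (hm₁ : 4 ≤ m₁) (hm₂ : 4 ≤ m₂)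
    (hE : 16 * n₁ ^ 4 < (m₂ + 1) ^ E)
    (hc : (n₂ : ℝ) ^ (2 * κ - 6) ≤ (2 : ℝ) ^ (23 - 13 * κ) * ((m₁ : ℝ) + 1) ^ (12 - 3 * κ))
    (hup : ∀ p d : ℕ, m₁ + 1 ≤ p → p ≤ n₁ → m₂ + 1 ≤ d → d ≤ n₂ →
      (2 : ℝ) ^ 24 * (p : ℝ) ^ 12 * (d : ℝ) ^ 6 ≤ ((p : ℝ) * (d : ℝ) ^ 2) ^ σ)
    (hX : (2 : ℝ) ^ 13 * (n₁ : ℝ) ^ 3 * (n₂ : ℝ) ^ 2 ≤ X) :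
    ((Finset.Ioc m₁ n₁).filter Nat.Prime).card *
        (((Finset.Ioc m₂ n₂).filter Nat.Prime).card - E) ≤ windowCount κ σ X := by
  classical
  set P := (Finset.Ioc m₁ n₁).filter Nat.Prime with hP
  set D := (Finset.Ioc m₂ n₂).filter Nat.Prime with hD
  have hPmem : ∀ p ∈ P, p.Prime ∧ m₁ + 1 ≤ p ∧ p ≤ n₁ := by
    intro p hp
    simp only [hP, Finset.mem_filter, Finset.mem_Ioc] at hp
    exact ⟨hp.2, hp.1.1, hp.1.2⟩
  have hDmem : ∀ d ∈ D, d.Prime ∧ m₂ + 1 ≤ d ∧ d ≤ n₂ := by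
    intro d hd
    simp only [hD, Finset.mem_filter, Finset.mem_Ioc] at hd
    exact ⟨hd.2, hd.1.1, hd.1.2⟩
  -- `Mn p = |AB(A+B)| = 4p²(4p²−1) ≤ 16 n₁⁴`
  set Mn : ℕ → ℕ := fun p ↦ ((1 : ℤ) * (3 * kOf p) * (1 + 3 * kOf p)).natAbs with hMn
  have hMnP : ∀ p ∈ P, 0 < Mn p ∧ Mn p ≤ 16 * n₁ ^ 4 := by
    intro p hp
    obtain ⟨hpr, hpm, hpn⟩ := hPmem p hp
    have hp3 := not_three_dvd_of_prime hpr (by omega)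
    obtain ⟨hn, hK⟩ := natAbs_freyFamily_prod hp3 hpr.one_le
    refine ⟨Int.natAbs_pos.mpr (freyFamily_prod_ne_zero hp3 hpr.one_le), ?_⟩
    show ((1 : ℤ) * (3 * kOf p) * (1 + 3 * kOf p)).natAbs ≤ 16 * n₁ ^ 4
    rw [hn]
    calc 3 * (kOf p).natAbs * (4 * p ^ 2) ≤ (4 * p ^ 2) * (4 * p ^ 2) := by
          apply Nat.mul_le_mul_right; omega
      _ = 16 * p ^ 4 := by ring
      _ ≤ 16 * n₁ ^ 4 := by gcongr
  set S := (P ×ˢ D).filter (fun x : ℕ × ℕ ↦ ¬ x.2 ∣ Mn x.1) with hS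
  have hSsub : (S : Set (ℕ × ℕ)) ⊆ ((P ×ˢ D : Finset (ℕ × ℕ)) : Set (ℕ × ℕ)) :=
    Finset.coe_subset.mpr (Finset.filter_subset _ _)
  have hinj : Set.InjOn (fun x : ℕ × ℕ ↦ twistFamily x.1 x.2) (S : Set (ℕ × ℕ)) :=
    (injOn_twistFamily' (fun p hp ↦ ⟨(hPmem p hp).1, by linarith [(hPmem p hp).2.1]⟩)
      (fun d hd ↦ (hDmem d hd).1)).mono hSsub
  have hsub : ((S.image fun x : ℕ × ℕ ↦ twistFamily x.1 x.2 : Finset (WeierstrassCurve ℤ)) :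
      Set (WeierstrassCurve ℤ)) ⊆ windowSet κ σ X := by
    intro W hW
    rw [Finset.coe_image] at hW
    obtain ⟨⟨p, d⟩, hx, rfl⟩ := hW
    rw [Finset.mem_coe, hS, Finset.mem_filter, Finset.mem_product] at hx
    obtain ⟨⟨hpP, hdD⟩, hndvd⟩ := hx
    obtain ⟨hp, hpm, hpn⟩ := hPmem p hpP
    obtain ⟨hd, hdm, hdn⟩ := hDmem d hdD
    have hdM : ¬ (d : ℤ) ∣ (1 : ℤ) * (3 * kOf p) * (1 + 3 * kOf p) :=
      fun h ↦ hndvd (Int.natCast_dvd.mp h)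
    refine twistFamily_mem_windowSet_of_edges (by linarith : (0 : ℝ) < κ) hσ0 hp hd (by omega)
      (by omega) hdM (lower_edge_of_corner hκ3 hκ4 hpm hdn hd.pos hc) (hup p d hpm hpn hdm hdn)
      (le_trans ?_ hX)
    have h1 : (p : ℝ) ≤ n₁ := by exact_mod_cast hpn
    have h2 : (d : ℝ) ≤ n₂ := by exact_mod_cast hdn
    gcongr
  have hcardS : S.card ≤ windowCount κ σ X := by
    calc S.card = (S.image fun x : ℕ × ℕ ↦ twistFamily x.1 x.2).card :=
          (Finset.card_image_of_injOn hinj).symm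
      _ = (((S.image fun x : ℕ × ℕ ↦ twistFamily x.1 x.2 : Finset (WeierstrassCurve ℤ)) :
            Set (WeierstrassCurve ℤ))).ncard := (Set.ncard_coe_finset _).symm
      _ ≤ windowCount κ σ X := Set.ncard_le_ncard hsub (windowSet_finite κ σ X)
  -- the bad pairs are few
  set Bad := (P ×ˢ D).filter (fun x : ℕ × ℕ ↦ x.2 ∣ Mn x.1) with hBad
  have hsplit : Bad.card + S.card = (P ×ˢ D).card :=
    Finset.card_filter_add_card_filter_not (s := P ×ˢ D) (fun x : ℕ × ℕ ↦ x.2 ∣ Mn x.1)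
  have hBadle : Bad.card ≤ P.card * E := by
    have hBadsub : Bad ⊆ P.biUnion (fun p ↦ (D.filter (· ∣ Mn p)).image (fun d ↦ (p, d))) := by
      rintro ⟨p, d⟩ hx
      rw [hBad, Finset.mem_filter, Finset.mem_product] at hx
      obtain ⟨⟨hpP, hdD⟩, hdiv⟩ := hx
      rw [Finset.mem_biUnion]
      exact ⟨p, hpP, Finset.mem_image.mpr ⟨d, Finset.mem_filter.mpr ⟨hdD, hdiv⟩, rfl⟩⟩
    calc Bad.card ≤ (P.biUnion (fun p ↦ (D.filter (· ∣ Mn p)).image (fun d ↦ (p, d)))).card :=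
          Finset.card_le_card hBadsub
      _ ≤ P.card * E := by
          refine Finset.card_biUnion_le_card_mul _ _ _ (fun p hp ↦ ?_)
          calc ((D.filter (· ∣ Mn p)).image (fun d ↦ (p, d))).card ≤ (D.filter (· ∣ Mn p)).card :=
                Finset.card_image_le
            _ ≤ E := (card_filter_dvd_lt (fun d hd ↦ ⟨(hDmem d hd).1, (hDmem d hd).2.1⟩)
                (hMnP p hp).1 ((hMnP p hp).2.trans_lt hE)).le
  -- combine
  have hprodcard : (P ×ˢ D).card = P.card * D.card := Finset.card_product _ _
  have hfinal : P.card * (D.card - E) ≤ S.card := by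
    rw [mul_tsub]
    generalize ha : P.card * D.card = a at *
    generalize hb : P.card * E = b at *
    omega
  exact hfinal.trans hcardS

end TwistEdges

end Summit.ABC.ABC.Theorems.SomeWindowSaving.Negative
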